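import Literature.Algebra.EuclideanLattices.GapCVPCoNPComplete
import Literature.Algebra.EuclideanLattices.DualGaussianSampling
import Literature.Algebra.EuclideanLattices.LatticeGapCVPNPcoNP
import HarnessLib

/-!
# Discharge of `FarCert.sample_exists`: good dual samples for the integer coNP certificate of `GapCVP_{c√n}`

Topic `Algebra/EuclideanLattices` (family `pqc`), continuing `GapCVPCoNPWitness.lean` (the integer
far-ness certificate `FarCert` for Aharonov–Regev 2005, Thm. 1.1, coNP part; soundness proved there)
and `GapCVPCoNPComplete.lean` (`FarCert.complete_of : sample_exists → psd_cert_exists → complete`).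
Everything here is PROVED; the main result is

* `FarCert.sample_exists_holds : FarCert.sample_exists` (from `FarCert.sample_exists_strong`, the
  same with the margin `100 · 20000 num² ‖A u‖² ≤ 99 · N den² ‖u B‖²`) — on a NO instance `((B, t), d)` of
  `GapCVP_{200√n}` there are `N = 40000 n⁴` integer vectors `aⱼ = B wⱼ` (`wⱼ ∈ L(B)*`) with
  `|aⱼₖ| ≤ 2^{q(L)}`, more than a quarter of the phases `aⱼ · (t adj B)/det B = ⟨t, wⱼ⟩` at distance
  `≥ 1/8` from `ℤ`, and the moment bound `20000 num² ‖A u‖² ≤ N den² ‖u B‖²` for all real `u`.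

This is Aharonov–Regev's §6.2 (completeness of the verifier) for the COUNTING test and the moment
threshold of the tree's `FarCert`, in the second-moment form of `DualGaussianSampling.lean`: the
`wⱼ` are i.i.d. samples of the dual discrete Gaussian `D_{L*,1/s}`, `s = 100 d`, and a good tuple
exists by the union bound over three bad events (`exists_good_farSamples`, a sibling of
`exists_good_dualSamples` with the distance-to-`ℤ` statistic replaced by the far COUNT):

* tail `‖wⱼ‖ ≥ 3√n/s` — Banaszczyk's Lemma 1.5 / AR Lemma 2.5 (`measureReal_dualGaussian_tail_le`),
  with `3√(2πe)e^{-9π} ≤ 3/2^{25}` (`banaszczykConst_three_le`) and `n⁴ ≤ 16ⁿ⁻¹`;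
* far count `≤ N Pr[far] − 3N/20` — Chebyshev (`IID.measureReal_sum_le_sub_le`), where
  `Pr[far] ≥ 2/5` (`two_fifths_le_of_bucketing`) comes from `E cos(2π⟨t, w⟩) = f_s(t)` (Claim 4.1,
  `tsum_gaussianFunction_sub_div_eq`), the BUCKETING `cos(2πy) ≥ 1 − π²/32` for `y` within `1/8` of
  `ℤ` (`sub_mul_farInd_le_cos`, integrated in `sub_le_mul_integral_farInd`), and
  `f_s(t) ≤ (2√(2πe)e^{-4π})ⁿ ≤ 2⁻⁹` at points with `dist(t, L) > 200√n d = 2 s √n` (Lemma 3.1,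
  `tsum_gaussianFunction_sub_le_pow_mul_of_forall_le`);
* Frobenius deviation of the truncated moment matrix `≥ θ`, `√θ = N den²/(10⁵ num²)` — Markov
  (`IID.measureReal_le_sum_sq_sub_le`); then `sum_inner_sq_le_of_good` (Lemma 2.6 / 6.2) gives
  `∑ⱼ ⟨v, wⱼ⟩² ≤ (Nπ/(8s²) + √θ)‖v‖²`, and `20000 num² (Nπ/(8s²) + √θ) = N den² (π/4 + 1/5) ≤ N den²`.

The translation to the integer data of `FarCert` (`LatticeInstance.dualSampleMatrix`,
`A j k = ⟪wⱼ, bₖ⟫ ∈ ℤ` by `mem_dualLattice`): phases `aⱼ · (t adj B) = det B ⟨t, wⱼ⟩`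
(`cast_phaseOf_dualSampleMatrix`, from `adj B · B = det B · I`), far phases are counted
(`far_of_le_distInt`, `sum_farInd_le_farCountOf`), `(A u)ⱼ = ⟨u B, wⱼ⟩`
(`dualSampleMatrix_mulVec_apply`), and `|A j k| ≤ ‖wⱼ‖ ‖bₖ‖ ≤ (3√n/s) · n 2^L ≤ 2^{4L}`.

Consequence (`gapSVP_sqrt_mem_promiseNP_inter_promiseCoNP_of_psd`): the vendored Cor. 1.2,
`gapSVP_sqrt_mem_promiseNP_inter_promiseCoNP`, is now conditional on exactly two named facts,
`FarCert.verifier_mem_P` (the TM2 verifier machine) and `FarCert.psd_cert_exists` (exact PSD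
certificates of polynomial size, Schrijver 1986 Thm. 3.3 with Lagrange's four squares).

Constants differ from print (AR05 use Chernoff–Hoeffding and an `ε`-net with `N = poly(n)` samples
and the tests `f_W < 1/2`, `‖WWᵀ‖ ≤ 3N`; here second moments, the counting test, `N = 40000 n⁴`,
`c₀ = 200`), as recorded in the docstrings (`— variant`).

## References

* D. Aharonov, O. Regev, *Lattice problems in NP ∩ coNP*, J. ACM 52 (2005) 749–765, §6.2
  (Claim 6.1, Lemmas 6.2, 6.3), Lemma 3.1, Claim 4.1, Lemmas 2.5–2.6 (pp. 7–12 of the preprint).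
* W. Banaszczyk, *New bounds in some transference theorems in the geometry of numbers*,
  Math. Ann. 296 (1993) 625–635, Lemma 1.5.
* C. Peikert, *A decade of lattice cryptography*, Found. Trends TCS 10 (2016), Def. 2.1.4 (dual lattice).
-/

noncomputable section

open MeasureTheory Module Metric Matrix
open Literature.NumberTheory.Sieve.Vinogradov Literature.Probability.Moments
open scoped Real InnerProductSpace

namespace Literature.Algebra.EuclideanLattices

/-! ### Bucketing the phases: `cos(2πy) ≥ 1 − π²/32` unless `y` is `1/8`-far from `ℤ` -/

/-- If `y` is within `1/8` of an integer then `cos(2πy) ≥ 1 − π²/32` (`cos u ≥ 1 − u²/2` at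
`u = 2π(y − round y)`, `|u| ≤ π/4`). [cite: AharonovRegev2005, §6.2 (Claim 6.1) — variant (bucketing for the counting test)] -/
theorem one_sub_pi_sq_div_le_cos_of_distInt_lt {y : ℝ} (h : distInt y < 1 / 8) :
    1 - π ^ 2 / 32 ≤ Real.cos (2 * π * y) := by
  have hper : Real.cos (2 * π * y) = Real.cos (2 * π * (y - round y)) := by
    rw [← Real.cos_add_int_mul_two_pi (2 * π * (y - round y)) (round y)]
    congr 1; ring
  rw [hper]
  have h1 : |y - round y| < 1 / 8 := h
  have h2 : (y - round y) ^ 2 ≤ (1 / 8) ^ 2 := by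
    rw [← sq_abs]
    exact pow_le_pow_left₀ (abs_nonneg _) h1.le 2
  have h3 : (2 * π * (y - round y)) ^ 2 / 2 ≤ π ^ 2 / 32 := by
    rw [mul_pow]
    nlinarith [sq_nonneg (2 * π)]
  linarith [Real.one_sub_sq_div_two_le_cos (x := 2 * π * (y - round y))]

variable {V : Type*} [NormedAddCommGroup V] [InnerProductSpace ℝ V]

/-- The far indicator `1[‖⟪x, w⟫‖_{ℝ/ℤ} ≥ 1/8]` of a dual vector `w` at the target `x` (the event
counted by the verifier's test `N < 4 · #far`). [cite: AharonovRegev2005, §6 test (a) — variant (counting form)] -/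
def farInd (x w : V) : ℝ := if 1 / 8 ≤ distInt ⟪x, w⟫_ℝ then 1 else 0

/-- `farInd` takes the values `0, 1`. [folklore] -/
theorem farInd_nonneg (x w : V) : 0 ≤ farInd x w := by
  unfold farInd; split_ifs <;> norm_num

/-- `farInd ≤ 1`. [folklore] -/
theorem farInd_le_one (x w : V) : farInd x w ≤ 1 := by
  unfold farInd; split_ifs <;> norm_num

/-- **Bucketing**: `cos(2π⟪x, w⟫) ≥ (1 − π²/32) − (2 − π²/32)·1[far]` (a near phase has cosine
`≥ 1 − π²/32`, any phase has cosine `≥ −1`). [cite: AharonovRegev2005, §6.2 (Claim 6.1) — variant] -/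
theorem sub_mul_farInd_le_cos (x w : V) :
    (1 - π ^ 2 / 32) - (2 - π ^ 2 / 32) * farInd x w ≤ Real.cos (2 * π * ⟪x, w⟫_ℝ) := by
  unfold farInd
  split_ifs with h
  · rw [mul_one]
    linarith [Real.neg_one_le_cos (2 * π * ⟪x, w⟫_ℝ)]
  · rw [mul_zero, sub_zero]
    exact one_sub_pi_sq_div_le_cos_of_distInt_lt (not_le.1 h)

variable [FiniteDimensional ℝ V] [MeasurableSpace V] [BorelSpace V]
variable (L : Submodule ℤ V) [DiscreteTopology L] [IsZLattice ℝ L]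

/-- Bounded functions are integrable against `D_{L*,1/s}`. [folklore] -/
theorem integrable_dualGaussian_of_bounded (s : ℝ) {g : dualLattice L → ℝ} {M : ℝ} (hg : ∀ w, |g w| ≤ M) :
    Integrable g (dualGaussian L s).toMeasure :=
  (memLp_of_bounded (a := -M) (b := M) (Filter.Eventually.of_forall fun x ↦ abs_le.1 (hg x))
      (measurable_of_countable g).aestronglyMeasurable 1).integrable le_rfl

/-- **The far event has probability at least `(1 − π²/32 − f_s(x))/(2 − π²/32)`** under
`D_{L*,1/s}`, where `f_s(x) = ρ_s(L − x)/ρ_s(L) = E cos(2π⟪x, w⟫)` (AR05 Claim 4.1; tree: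
`tsum_gaussianFunction_sub_div_eq`) and the bucketing inequality is integrated.
[cite: AharonovRegev2005, Claim 4.1 and §6.2 (Claim 6.1) — variant (counting form)] -/
theorem sub_le_mul_integral_farInd {s : ℝ} (hs : 0 < s) (x : V) :
    (1 - π ^ 2 / 32) - (∑' y : L, gaussianFunction s ((y : V) - x)) / (∑' y : L, gaussianFunction s (y : V)) ≤
      (2 - π ^ 2 / 32) * ∫ w, farInd x ((w : dualLattice L) : V) ∂(dualGaussian L s).toMeasure := by
  set μ := (dualGaussian L s).toMeasure with hμ
  have hcos : ∫ w, Real.cos (2 * π * ⟪x, ((w : dualLattice L) : V)⟫_ℝ) ∂μ =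
      (∑' y : L, gaussianFunction s ((y : V) - x)) / ∑' y : L, gaussianFunction s (y : V) := by
    rw [hμ, integral_dualGaussian_eq L hs (M := 1) (fun w ↦ Real.abs_cos_le_one _),
      tsum_gaussianFunction_sub_div_eq L hs x]
  have hint_cos : Integrable (fun w : dualLattice L ↦ Real.cos (2 * π * ⟪x, (w : V)⟫_ℝ)) μ :=
    integrable_dualGaussian_of_bounded L s (M := 1) fun w ↦ Real.abs_cos_le_one _
  have hint_ind : Integrable (fun w : dualLattice L ↦ farInd x (w : V)) μ :=
    integrable_dualGaussian_of_bounded L s (M := 1) fun w ↦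
      abs_le.2 ⟨by linarith [farInd_nonneg x (w : V)], farInd_le_one x _⟩
  have hint_lhs : Integrable (fun w : dualLattice L ↦ (1 - π ^ 2 / 32) - (2 - π ^ 2 / 32) * farInd x (w : V)) μ :=
    (integrable_const _).sub (hint_ind.const_mul _)
  have hmono := integral_mono hint_lhs hint_cos fun w ↦ sub_mul_farInd_le_cos x ((w : dualLattice L) : V)
  rw [integral_sub (integrable_const _) (hint_ind.const_mul _), integral_const, integral_const_mul, hcos] at hmono
  simp only [probReal_univ, one_smul] at hmono
  linarith

section Existence

variable {ι : Type*} [Fintype ι]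

/-- **Good witness tuples for the counting verifier exist** (the probabilistic method over
`D_{L*,1/s}^N`, second-moment form, for the tests of `FarCert`): with `R = c√n/s`, if
`N (c√(2πe)e^{-πc²})ⁿ + N/(4a²) + N n² R⁴/θ < 1` then some `(w₁, …, w_N) ∈ (L*)^N` has (i) all
`‖wⱼ‖ < R`, (ii) `#{j : ‖⟪x, wⱼ⟫‖_{ℝ/ℤ} ≥ 1/8} > N · Pr[far] − a`, (iii) squared Frobenius deviation
`< θ` of the truncated empirical moment matrix from `N` times its mean. Same three tools as
`exists_good_dualSamples` (union bound, Chebyshev, Markov of `IIDSecondMoment.lean`), with the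
distance-to-`ℤ` statistic replaced by the far COUNT. (In print: Claim 6.1 and Lemmas 6.2–6.3 with
Chernoff–Hoeffding and an `ε`-net.) [cite: AharonovRegev2005, §6.2 (Claim 6.1, Lemmas 6.2–6.3, pp. 11–12) — variant] -/
theorem exists_good_farSamples {s c a θ : ℝ} (hs : 0 < s) (hc : 1 / Real.sqrt (2 * π) ≤ c) (ha : 0 < a) (hθ : 0 < θ)
    (x : V) (b : OrthonormalBasis ι ℝ V) (N : ℕ)
    (hbudget : N * (c * Real.sqrt (2 * π * Real.exp 1) * Real.exp (-π * c ^ 2)) ^ finrank ℝ V +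
        N * 1 ^ 2 / (4 * a ^ 2) +
        N * Fintype.card (ι × ι) * ((c * s⁻¹ * Real.sqrt (finrank ℝ V)) ^ 2) ^ 2 / θ < 1) :
    ∃ ω : Fin N → dualLattice L,
      (∀ j, ‖(ω j : V)‖ < c * s⁻¹ * Real.sqrt (finrank ℝ V)) ∧
      (N * (∫ w, farInd x ((w : dualLattice L) : V) ∂(dualGaussian L s).toMeasure) - a <
        ∑ j, farInd x (ω j : V)) ∧
      (∑ k : ι × ι, (∑ j, momentEntry b (c * s⁻¹ * Real.sqrt (finrank ℝ V)) k (ω j : V) -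
          N * ∫ w, momentEntry b (c * s⁻¹ * Real.sqrt (finrank ℝ V)) k (w : V) ∂(dualGaussian L s).toMeasure) ^ 2 < θ) := by
  set R : ℝ := c * s⁻¹ * Real.sqrt (finrank ℝ V) with hR
  have hc0 : 0 < c := lt_of_lt_of_le (by positivity) hc
  have hR0 : 0 ≤ R := by rw [hR]; positivity
  set μ := (dualGaussian L s).toMeasure with hμ
  set B1 : Set (Fin N → dualLattice L) := {ω | ∃ j, ω j ∈ {w : dualLattice L | R ≤ ‖(w : V)‖}} with hB1
  set m : ℝ := ∫ w, farInd x ((w : dualLattice L) : V) ∂μ with hm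
  set B2 : Set (Fin N → dualLattice L) := {ω | ∑ j, farInd x ((ω j : dualLattice L) : V) ≤ N * m - a} with hB2
  set B3 : Set (Fin N → dualLattice L) := {ω | θ ≤ ∑ k : ι × ι, (∑ j, momentEntry b R k (ω j : V) -
      N * ∫ w, momentEntry b R k (w : V) ∂μ) ^ 2} with hB3
  have h1 : (IID.draws μ N).real B1 ≤ N * (c * Real.sqrt (2 * π * Real.exp 1) * Real.exp (-π * c ^ 2)) ^ finrank ℝ V := by
    refine (IID.measureReal_exists_mem_le (μ := μ) (N := N) _).trans ?_
    exact mul_le_mul_of_nonneg_left (measureReal_dualGaussian_tail_le L hs hc) (Nat.cast_nonneg _)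
  have h2 : (IID.draws μ N).real B2 ≤ N * 1 ^ 2 / (4 * a ^ 2) :=
    IID.measureReal_sum_le_sub_le (μ := μ) (N := N) (g := fun w : dualLattice L ↦ farInd x (w : V))
      (fun w ↦ farInd_nonneg _ _) (fun w ↦ farInd_le_one _ _) ha
  have h3 : (IID.draws μ N).real B3 ≤ N * Fintype.card (ι × ι) * (R ^ 2) ^ 2 / θ :=
    IID.measureReal_le_sum_sq_sub_le (μ := μ) (N := N) (h := fun k (w : dualLattice L) ↦ momentEntry b R k (w : V))
      (fun k w ↦ abs_momentEntry_le b hR0 k _) hθ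
  have hunion : (IID.draws μ N).real (B1 ∪ B2 ∪ B3) < 1 :=
    calc (IID.draws μ N).real (B1 ∪ B2 ∪ B3) ≤ (IID.draws μ N).real B1 + (IID.draws μ N).real B2 + (IID.draws μ N).real B3 :=
          (measureReal_union_le _ _).trans (add_le_add (measureReal_union_le _ _) le_rfl)
      _ ≤ _ := add_le_add (add_le_add h1 h2) h3
      _ < 1 := hbudget
  obtain ⟨ω, hω⟩ := IID.exists_not_mem_of_measureReal_lt_one hunion
  simp only [Set.mem_union, not_or, hB1, hB2, hB3, Set.mem_setOf_eq, not_exists, not_le] at hω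
  obtain ⟨⟨hω1, hω2⟩, hω3⟩ := hω
  exact ⟨ω, hω1, hω2, hω3⟩

end Existence

/-! ### Far-ness in integer form -/

/-- If `p/δ` is `1/8`-far from `ℤ` then the integer test `|δ| ≤ 8 r ∧ |δ| ≤ 8(|δ| − r)`,
`r = p mod |δ|`, holds. [cite: AharonovRegev2005, §6 test (a) (counting form)] -/
theorem far_of_le_distInt {p δ : ℤ} (hδ : δ ≠ 0) (h : 1 / 8 ≤ distInt ((p : ℝ) / δ)) :
    (δ.natAbs : ℤ) ≤ 8 * (p % δ.natAbs) ∧ (δ.natAbs : ℤ) ≤ 8 * (δ.natAbs - p % δ.natAbs) := by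
  set D : ℤ := (δ.natAbs : ℤ) with hD
  have hDpos : 0 < D := by rw [hD]; exact_mod_cast Int.natAbs_pos.2 hδ
  have hr0 : 0 ≤ p % D := Int.emod_nonneg _ hDpos.ne'
  have hrD : p % D < D := Int.emod_lt_of_pos _ hDpos
  have hdecomp : p % D + D * (p / D) = p := Int.emod_add_mul_ediv p D
  set q := p / D
  set r := p % D
  -- `distInt (p/δ) = distInt (r/D)`
  have hDR : (0 : ℝ) < D := by exact_mod_cast hDpos
  have hdist : distInt ((p : ℝ) / δ) = distInt ((r : ℝ) / D) := by
    have hpD : distInt ((p : ℝ) / D) = distInt ((r : ℝ) / D) := by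
      have : (p : ℝ) / D = (r : ℝ) / D + (q : ℤ) := by
        have hp : (p : ℝ) = r + D * q := by exact_mod_cast hdecomp.symm
        rw [hp]; field_simp
      rw [this, distInt_add_int]
    rcases Int.natAbs_eq δ with hδ' | hδ'
    · have hcast : (δ : ℝ) = (D : ℝ) := by rw [hD]; exact congrArg (Int.cast : ℤ → ℝ) hδ'
      rw [← hpD, hcast]
    · have hcast : (δ : ℝ) = -(D : ℝ) := by
        rw [hD, ← Int.cast_neg]; exact congrArg (Int.cast : ℤ → ℝ) hδ'
      rw [← hpD, ← distInt_neg ((p : ℝ) / D), hcast, div_neg]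
  rw [hdist] at h
  constructor
  · have h1 : distInt ((r : ℝ) / D) ≤ |(r : ℝ) / D - (0 : ℤ)| := distInt_le_abs_sub_int _ _
    rw [Int.cast_zero, sub_zero, abs_of_nonneg (div_nonneg (by exact_mod_cast hr0) hDR.le)] at h1
    have h2 : (1 : ℝ) / 8 ≤ (r : ℝ) / D := h.trans h1
    rw [div_le_div_iff₀ (by norm_num) hDR, one_mul] at h2
    have h3 : (D : ℝ) ≤ 8 * r := by linarith
    exact_mod_cast h3
  · have h1 : distInt ((r : ℝ) / D) ≤ |(r : ℝ) / D - (1 : ℤ)| := distInt_le_abs_sub_int _ _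
    have hle : (r : ℝ) / D ≤ 1 := by rw [div_le_one hDR]; exact_mod_cast hrD.le
    rw [Int.cast_one, abs_of_nonpos (by linarith), neg_sub] at h1
    have h2 : (1 : ℝ) / 8 ≤ 1 - (r : ℝ) / D := h.trans h1
    have h3 : (1 : ℝ) - (r : ℝ) / D = ((D : ℝ) - r) / D := by field_simp
    rw [h3, div_le_div_iff₀ (by norm_num) hDR, one_mul] at h2
    have h4 : (D : ℝ) ≤ 8 * (D - r) := by linarith
    exact_mod_cast h4

/-! ### Numerical constants -/

/-- `e⁻ᵏ ≤ 2⁻ᵏ`. [folklore] -/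
theorem exp_neg_natCast_le (k : ℕ) : Real.exp (-(k : ℝ)) ≤ 1 / 2 ^ k := by
  rw [Real.exp_neg, one_div]
  refine inv_anti₀ (by positivity) ?_
  rw [show (k : ℝ) = k * 1 by ring, Real.exp_nat_mul]
  exact pow_le_pow_left₀ (by norm_num) (by linarith [Real.add_one_le_exp (1 : ℝ)]) k

/-- The truncation constant: `3√(2πe) e^{-9π} ≤ 3/2^25`. [folklore] -/
theorem banaszczykConst_three_le : 3 * Real.sqrt (2 * π * Real.exp 1) * Real.exp (-π * 3 ^ 2) ≤ 3 / 2 ^ 25 := by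
  have h0 := sqrt_two_pi_e_mul_exp_neg_pi_le
  have hsplit : Real.exp (-π * 3 ^ 2) = Real.exp (-π) * Real.exp (-(8 * π)) := by
    rw [← Real.exp_add]; congr 1; ring
  have h8 : Real.exp (-(8 * π)) ≤ 1 / 2 ^ 24 := by
    refine le_trans (Real.exp_le_exp.2 ?_) (exp_neg_natCast_le 24)
    push_cast; linarith [Real.pi_gt_three]
  have hpos : 0 ≤ Real.sqrt (2 * π * Real.exp 1) := Real.sqrt_nonneg _
  calc 3 * Real.sqrt (2 * π * Real.exp 1) * Real.exp (-π * 3 ^ 2)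
      = 3 * (Real.sqrt (2 * π * Real.exp 1) * Real.exp (-π)) * Real.exp (-(8 * π)) := by rw [hsplit]; ring
    _ ≤ 3 * 2⁻¹ * (1 / 2 ^ 24) := by
        gcongr
    _ = 3 / 2 ^ 25 := by norm_num

/-- The tail constant for `f`: `2√(2πe) e^{-4π} ≤ 1/2^9`. [folklore] -/
theorem banaszczykConst_two_le : 2 * Real.sqrt (2 * π * Real.exp 1) * Real.exp (-π * 2 ^ 2) ≤ 1 / 2 ^ 9 := by
  have h0 := sqrt_two_pi_e_mul_exp_neg_pi_le
  have hsplit : Real.exp (-π * 2 ^ 2) = Real.exp (-π) * Real.exp (-(3 * π)) := by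
    rw [← Real.exp_add]; congr 1; ring
  have h3 : Real.exp (-(3 * π)) ≤ 1 / 2 ^ 9 := by
    refine le_trans (Real.exp_le_exp.2 ?_) (exp_neg_natCast_le 9)
    push_cast; linarith [Real.pi_gt_three]
  calc 2 * Real.sqrt (2 * π * Real.exp 1) * Real.exp (-π * 2 ^ 2)
      = 2 * (Real.sqrt (2 * π * Real.exp 1) * Real.exp (-π)) * Real.exp (-(3 * π)) := by rw [hsplit]; ring
    _ ≤ 2 * 2⁻¹ * (1 / 2 ^ 9) := by
        gcongr
    _ = 1 / 2 ^ 9 := by norm_num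

/-- `n⁴ ≤ 16ⁿ⁻¹` for `n ≥ 1`, in the form `(m+1)⁴ ≤ 16ᵐ`. [folklore] -/
theorem succ_pow_four_le (m : ℕ) : (m + 1) ^ 4 ≤ 16 ^ m := by
  induction m with
  | zero => norm_num
  | succ k ih =>
    have h1 : (k + 2) ^ 4 ≤ 16 * (k + 1) ^ 4 := by
      have : k + 2 ≤ 2 * (k + 1) := by omega
      calc (k + 2) ^ 4 ≤ (2 * (k + 1)) ^ 4 := Nat.pow_le_pow_left this 4
        _ = 16 * (k + 1) ^ 4 := by ring
    calc (k + 1 + 1) ^ 4 = (k + 2) ^ 4 := by ring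
      _ ≤ 16 * (k + 1) ^ 4 := h1
      _ ≤ 16 * 16 ^ k := Nat.mul_le_mul_left _ ih
      _ = 16 ^ (k + 1) := by ring

/-- `1/√(2π) ≤ 1`. [folklore] -/
theorem one_div_sqrt_two_pi_le_one : 1 / Real.sqrt (2 * π) ≤ 1 := by
  rw [div_le_one (Real.sqrt_pos.2 (by positivity))]
  exact Real.one_le_sqrt.2 (by linarith [Real.pi_gt_three])


/-- `(2√(2πe) e^{-4π})ⁿ ≤ 1/2^9` for `n ≥ 1`. [folklore] -/
theorem banaszczykConst_two_pow_le {n : ℕ} (hn : n ≠ 0) :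
    (2 * Real.sqrt (2 * π * Real.exp 1) * Real.exp (-π * 2 ^ 2)) ^ n ≤ 1 / 2 ^ 9 :=
  (pow_le_of_le_one (by positivity) (banaszczykConst_two_le.trans (by norm_num)) hn).trans banaszczykConst_two_le

/-- The tail term of the budget: `40000 (m+1)⁴ ρ^{m+1} ≤ 1/4` for `0 ≤ ρ ≤ 3/2^25`. [folklore] -/
theorem sample_term1_le (m : ℕ) {ρ : ℝ} (h0 : 0 ≤ ρ) (h1 : ρ ≤ 3 / 2 ^ 25) :
    40000 * ((m + 1 : ℕ) : ℝ) ^ 4 * ρ ^ (m + 1) ≤ 1 / 4 := by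
  have hpow : ((m + 1 : ℕ) : ℝ) ^ 4 ≤ (16 : ℝ) ^ m := by exact_mod_cast succ_pow_four_le m
  have h16 : (16 * ρ) ^ m ≤ 1 := pow_le_one₀ (by positivity) (by linarith)
  calc 40000 * ((m + 1 : ℕ) : ℝ) ^ 4 * ρ ^ (m + 1) ≤ 40000 * (16 : ℝ) ^ m * ρ ^ (m + 1) := by gcongr
    _ = 40000 * (16 * ρ) ^ m * ρ := by rw [mul_pow, pow_succ]; ring
    _ ≤ 40000 * 1 * (3 / 2 ^ 25) := by gcongr
    _ ≤ 1 / 4 := by norm_num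

/-- **The budget of the three bad events is `< 1`** for the parameters of `sample_exists_holds`
(`N = 40000 n⁴`, `s = 100 num/den`, truncation `c = 3`, count deviation `a = 3N/20`, Frobenius level
`θ = (N den²/(10⁵ num²))²`): tail `≤ 1/4`, count `≤ 1/100`, moments `= 81/400`. [folklore] -/
theorem sample_budget_lt_one {n : ℕ} (hn : 1 ≤ n) {num den s θ a N : ℝ} (hnum : 0 < num) (hden : 0 < den)
    (hs : s = 100 * (num / den)) (hN : N = 40000 * (n : ℝ) ^ 4) (hθ : θ = (N * den ^ 2 / (100000 * num ^ 2)) ^ 2)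
    (ha : a = 3 * N / 20) :
    N * (3 * Real.sqrt (2 * π * Real.exp 1) * Real.exp (-π * 3 ^ 2)) ^ n + N * 1 ^ 2 / (4 * a ^ 2) +
      N * ((n * n : ℕ) : ℝ) * ((3 * s⁻¹ * Real.sqrt n) ^ 2) ^ 2 / θ < 1 := by
  have hn0 : (0 : ℝ) < n := by exact_mod_cast hn
  have hn1 : (1 : ℝ) ≤ n := by exact_mod_cast hn
  have hNpos : 0 < N := by rw [hN]; positivity
  have hNge : 40000 ≤ N := by
    rw [hN]
    have h4 : (1 : ℝ) ≤ (n : ℝ) ^ 4 := one_le_pow₀ hn1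
    linarith
  have hspos : 0 < s := by rw [hs]; positivity
  have hθpos : 0 < θ := by rw [hθ]; positivity
  -- term 1
  have hT1 : N * (3 * Real.sqrt (2 * π * Real.exp 1) * Real.exp (-π * 3 ^ 2)) ^ n ≤ 1 / 4 := by
    obtain ⟨m, rfl⟩ : ∃ m, n = m + 1 := ⟨n - 1, by omega⟩
    rw [hN]
    exact sample_term1_le m (by positivity) banaszczykConst_three_le
  -- term 2
  have hT2 : N * 1 ^ 2 / (4 * a ^ 2) ≤ 1 / 100 := by
    rw [ha, div_le_div_iff₀ (by positivity) (by norm_num)]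
    have : 40000 * N ≤ N * N := mul_le_mul_of_nonneg_right hNge hNpos.le
    nlinarith
  -- term 3
  have hT3 : N * ((n * n : ℕ) : ℝ) * ((3 * s⁻¹ * Real.sqrt n) ^ 2) ^ 2 / θ = 81 / 400 := by
    have hsq : Real.sqrt (n : ℝ) ^ 2 = n := Real.sq_sqrt hn0.le
    have e1 : (3 * s⁻¹ * Real.sqrt (n : ℝ)) ^ 2 = 9 * n / s ^ 2 := by rw [mul_pow, mul_pow, hsq, inv_pow]; ring
    rw [e1, hθ, hN, hs]
    push_cast
    field_simp
    ring
  linarith [hT3.le]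

/-- **The moment threshold**: `20000 num² (Nπ/(8s²) + √θ) ≤ N den²` for `s = 100 num/den`,
`√θ = N den²/(10⁵ num²)` (`π/4 + 1/5 ≤ 1`). [folklore] -/
theorem sample_moment_coef_le {num den s θ N : ℝ} (hnum : 0 < num) (hden : 0 < den) (hN : 0 ≤ N)
    (hs : s = 100 * (num / den)) (hθ : θ = (N * den ^ 2 / (100000 * num ^ 2)) ^ 2) :
    20000 * num ^ 2 * (N * (π / (8 * s ^ 2)) + Real.sqrt θ) ≤ N * den ^ 2 := by
  have hroot : 0 ≤ N * den ^ 2 / (100000 * num ^ 2) := by positivity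
  rw [hθ, Real.sqrt_sq hroot, hs]
  have e : 20000 * num ^ 2 * (N * (π / (8 * (100 * (num / den)) ^ 2)) + N * den ^ 2 / (100000 * num ^ 2)) =
      N * den ^ 2 * (π / 4 + 1 / 5) := by
    field_simp
    ring
  rw [e]
  have hπ : π / 4 + 1 / 5 ≤ 1 := by linarith [Real.pi_lt_d2]
  have h0 : 0 ≤ N * den ^ 2 := by positivity
  nlinarith

/-- **The moment threshold with a margin**: `100 · 20000 num² (Nπ/(8s²) + √θ) ≤ 99 · N den²`
(`π/4 + 1/5 ≤ 99/100`). [folklore] -/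
theorem sample_moment_coef_le_strong {num den s θ N : ℝ} (hnum : 0 < num) (hden : 0 < den) (hN : 0 ≤ N)
    (hs : s = 100 * (num / den)) (hθ : θ = (N * den ^ 2 / (100000 * num ^ 2)) ^ 2) :
    100 * (20000 * num ^ 2 * (N * (π / (8 * s ^ 2)) + Real.sqrt θ)) ≤ 99 * (N * den ^ 2) := by
  have hroot : 0 ≤ N * den ^ 2 / (100000 * num ^ 2) := by positivity
  rw [hθ, Real.sqrt_sq hroot, hs]
  have e : 20000 * num ^ 2 * (N * (π / (8 * (100 * (num / den)) ^ 2)) + N * den ^ 2 / (100000 * num ^ 2)) =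
      N * den ^ 2 * (π / 4 + 1 / 5) := by
    field_simp
    ring
  rw [e]
  have hπ : 100 * (π / 4 + 1 / 5) ≤ 99 := by linarith [Real.pi_lt_d2]
  have h0 : 0 ≤ N * den ^ 2 := by positivity
  nlinarith

/-- **The truncation radius against the data**: `3√n/s ≤ n · den` for `s = 100 num/den`, `num ≥ 1`.
[folklore] -/
theorem sample_radius_le {n : ℕ} (hn : 1 ≤ n) {num den s : ℝ} (hnum : 1 ≤ num) (hden : 0 < den)
    (hs : s = 100 * (num / den)) : 3 * s⁻¹ * Real.sqrt n ≤ n * den := by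
  have hn1 : (1 : ℝ) ≤ n := by exact_mod_cast hn
  have hsq : Real.sqrt (n : ℝ) ≤ n := by
    rw [Real.sqrt_le_left (by positivity)]
    exact le_self_pow₀ hn1 two_ne_zero
  have hspos : 0 < s := by rw [hs]; positivity
  have h3s : 3 * s⁻¹ ≤ den := by
    rw [mul_inv_le_iff₀ hspos, hs, show den * (100 * (num / den)) = 100 * num by field_simp]
    linarith
  calc 3 * s⁻¹ * Real.sqrt (n : ℝ) ≤ den * n := mul_le_mul h3s hsq (Real.sqrt_nonneg _) hden.le
    _ = n * den := by ring

/-- **The far probability is at least `2/5`**: from the bucketing inequality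
`(1 − π²/32) − f ≤ (2 − π²/32) Pr[far]` and `f ≤ 2⁻⁹` (`π² < 9.93`). [folklore] -/
theorem two_fifths_le_of_bucketing {f m : ℝ} (h : (1 - π ^ 2 / 32) - f ≤ (2 - π ^ 2 / 32) * m)
    (hf : f ≤ 1 / 2 ^ 9) : 2 / 5 ≤ m := by
  have hπ2 : π ^ 2 < 9.93 := by nlinarith [Real.pi_lt_d2, Real.pi_pos]
  have hP : 0 < 2 - π ^ 2 / 32 := by nlinarith
  by_contra hlt
  push Not at hlt
  have := mul_lt_mul_of_pos_left hlt hP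
  linarith

/-! ### The integer coordinates `aⱼ = B wⱼ` of dual vectors -/

namespace LatticeInstance

variable (I : LatticeInstance)

/-- For `w ∈ L(B)*` and a basis row `bₖ ∈ L(B)`, `⟪w, bₖ⟫ ∈ ℤ`. [cite: Peikert2016, Def. 2.1.4] -/
theorem exists_int_cast_eq_inner_vec (w : dualLattice I.lattice) (k : Fin I.n) :
    ∃ m : ℤ, (m : ℝ) = ⟪(w : EuclideanSpace ℝ (Fin I.n)), I.vec k⟫_ℝ :=
  mem_dualLattice.1 w.2 (I.vec k) (by
    rw [LatticeInstance.lattice]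
    exact Submodule.subset_span (Set.mem_range_self k))

/-- **The integer sample matrix** of a tuple of dual vectors `(w₁, …, w_N) ∈ (L(B)*)^N`:
`A j k = ⟪wⱼ, bₖ⟫ ∈ ℤ`, i.e. row `j` is `aⱼ = B wⱼ` (the integer coordinates by which the verifier
`FarCert` receives the dual samples of Aharonov–Regev's witness). [cite: AharonovRegev2005, §6 (p. 10, the witness matrix W) — variant (integer coordinates)] -/
def dualSampleMatrix {N : ℕ} (ω : Fin N → dualLattice I.lattice) : Matrix (Fin N) (Fin I.n) ℤ :=
  Matrix.of fun j k => (I.exists_int_cast_eq_inner_vec (ω j) k).choose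

/-- `A j k = ⟪wⱼ, bₖ⟫`. [cite: AharonovRegev2005, §6 (p. 10) — variant] -/
theorem cast_dualSampleMatrix {N : ℕ} (ω : Fin N → dualLattice I.lattice) (j : Fin N) (k : Fin I.n) :
    ((I.dualSampleMatrix ω j k : ℤ) : ℝ) = ⟪((ω j : dualLattice I.lattice) : EuclideanSpace ℝ (Fin I.n)), I.vec k⟫_ℝ :=
  (I.exists_int_cast_eq_inner_vec (ω j) k).choose_spec

/-- `⟪w, bₖ⟫ = ∑ₗ wₗ Bₖₗ`. [folklore] -/
theorem inner_vec_eq_sum (w : EuclideanSpace ℝ (Fin I.n)) (k : Fin I.n) :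
    ⟪w, I.vec k⟫_ℝ = ∑ l, w l * (I.basis k l : ℝ) := by
  simp [PiLp.inner_apply, mul_comm]

/-- **The phases of the integer samples**: `aⱼ · (t adj B) = det B · ⟪t, wⱼ⟫`
(`adj B · B = det B · I`). [cite: AharonovRegev2005, §6 test (a) — variant (integer form)] -/
theorem cast_phaseOf_dualSampleMatrix {N : ℕ} (ω : Fin N → dualLattice I.lattice) (t : Fin I.n → ℤ) (j : Fin N) :
    ((FarCert.phaseOf (I.dualSampleMatrix ω) I.basis.adjugate t j : ℤ) : ℝ) =
      (I.basis.det : ℝ) * ⟪intVecToEuclidean I.n t, ((ω j : dualLattice I.lattice) : EuclideanSpace ℝ (Fin I.n))⟫_ℝ := by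
  have key : (t ᵥ* I.basis.adjugate) ᵥ* I.basis = I.basis.det • t :=
    FarCert.vecMul_vecMul_of_mul_eq_smul (Matrix.adjugate_mul I.basis) t
  set v := t ᵥ* I.basis.adjugate with hv
  have h1 : FarCert.phaseOf (I.dualSampleMatrix ω) I.basis.adjugate t j = ∑ k, I.dualSampleMatrix ω j k * v k := rfl
  have h2 : ∀ l, ∑ k, (v k : ℝ) * (I.basis k l : ℝ) = (I.basis.det : ℝ) * (t l : ℝ) := fun l ↦ by
    have e := congrFun key l
    simp only [Matrix.vecMul, dotProduct, Pi.smul_apply, smul_eq_mul] at e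
    exact_mod_cast e
  have h3 : ⟪intVecToEuclidean I.n t, ((ω j : dualLattice I.lattice) : EuclideanSpace ℝ (Fin I.n))⟫_ℝ =
      ∑ l, (t l : ℝ) * ((ω j : dualLattice I.lattice) : EuclideanSpace ℝ (Fin I.n)) l := by
    simp [PiLp.inner_apply, mul_comm]
  rw [h1, h3, Int.cast_sum]
  simp_rw [Int.cast_mul, cast_dualSampleMatrix, inner_vec_eq_sum, Finset.sum_mul]
  rw [Finset.sum_comm, Finset.mul_sum]
  refine Finset.sum_congr rfl fun l _ ↦ ?_
  calc ∑ k, ((ω j : dualLattice I.lattice) : EuclideanSpace ℝ (Fin I.n)) l * (I.basis k l : ℝ) * (v k : ℝ)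
      = ((ω j : dualLattice I.lattice) : EuclideanSpace ℝ (Fin I.n)) l * ∑ k, (v k : ℝ) * (I.basis k l : ℝ) := by
        rw [Finset.mul_sum]
        exact Finset.sum_congr rfl fun k _ ↦ by ring
    _ = _ := by rw [h2 l]; ring

/-- **Far phases are counted**: the number of samples whose phase `⟪t, wⱼ⟫` is `1/8`-far from `ℤ`
is at most the verifier's far count of `(A, adj B, det B)`. [cite: AharonovRegev2005, §6 test (a) — variant (counting form)] -/
theorem sum_farInd_le_farCountOf (hI : I.IsNonsingular) {N : ℕ} (ω : Fin N → dualLattice I.lattice) (t : Fin I.n → ℤ) :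
    ∑ j, farInd (intVecToEuclidean I.n t) ((ω j : dualLattice I.lattice) : EuclideanSpace ℝ (Fin I.n)) ≤
      (FarCert.farCountOf (I.dualSampleMatrix ω) I.basis.adjugate I.basis.det t : ℝ) := by
  have hdet : (I.basis.det : ℝ) ≠ 0 := by exact_mod_cast hI
  unfold farInd FarCert.farCountOf
  rw [Finset.sum_boole]
  have hsub : Finset.univ.filter (fun j : Fin N ↦ 1 / 8 ≤ distInt ⟪intVecToEuclidean I.n t,
      ((ω j : dualLattice I.lattice) : EuclideanSpace ℝ (Fin I.n))⟫_ℝ) ⊆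
      Finset.univ.filter (FarCert.FarOf (I.dualSampleMatrix ω) I.basis.adjugate I.basis.det t) := by
    intro j hj
    simp only [Finset.mem_filter, Finset.mem_univ, true_and] at hj ⊢
    refine far_of_le_distInt hI ?_
    rwa [cast_phaseOf_dualSampleMatrix, mul_div_cancel_left₀ _ hdet]
  exact_mod_cast Finset.card_le_card hsub

/-- `‖bₖ‖ ≤ n · M` if all entries of `B` are at most `M` in absolute value. [folklore] -/
theorem norm_vec_le {M : ℕ} (hM : ∀ i k, (I.basis i k).natAbs ≤ M) (k : Fin I.n) : ‖I.vec k‖ ≤ I.n * M := by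
  rw [LatticeInstance.vec, norm_intVecToEuclidean, Real.sqrt_le_left (by positivity)]
  have h1 : ∀ l, ((I.basis k l : ℝ)) ^ 2 ≤ (M : ℝ) ^ 2 := fun l ↦ by
    have h' : |(I.basis k l : ℝ)| ≤ M := by
      have h2 : (|I.basis k l| : ℤ) ≤ (M : ℤ) := by
        rw [← Int.natCast_natAbs]; exact_mod_cast hM k l
      have h3 : ((|I.basis k l| : ℤ) : ℝ) ≤ ((M : ℤ) : ℝ) := by exact_mod_cast h2
      rwa [Int.cast_abs, Int.cast_natCast] at h3
    rw [← sq_abs]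
    exact pow_le_pow_left₀ (abs_nonneg _) h' 2
  calc ∑ l, ((I.basis k l : ℝ)) ^ 2 ≤ ∑ _l : Fin I.n, (M : ℝ) ^ 2 := Finset.sum_le_sum fun l _ ↦ h1 l
    _ = I.n * (M : ℝ) ^ 2 := by simp
    _ ≤ (I.n * M : ℝ) ^ 2 := by
        rw [mul_pow]
        refine mul_le_mul_of_nonneg_right ?_ (by positivity)
        rcases Nat.eq_zero_or_pos I.n with h0 | hpos
        · simp [h0]
        · exact le_self_pow₀ (by exact_mod_cast hpos) two_ne_zero

/-- **Entries of the sample matrix**: `|A j k| ≤ ‖wⱼ‖ ‖bₖ‖ ≤ R · n · M`. [folklore] -/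
theorem natAbs_dualSampleMatrix_le {N : ℕ} (ω : Fin N → dualLattice I.lattice) {R : ℝ}
    (hω : ∀ j, ‖((ω j : dualLattice I.lattice) : EuclideanSpace ℝ (Fin I.n))‖ ≤ R)
    {M : ℕ} (hM : ∀ i k, (I.basis i k).natAbs ≤ M) (j : Fin N) (k : Fin I.n) :
    ((I.dualSampleMatrix ω j k).natAbs : ℝ) ≤ R * (I.n * M) := by
  have hR : 0 ≤ R := (norm_nonneg _).trans (hω j)
  have h1 : ((I.dualSampleMatrix ω j k).natAbs : ℝ) = |((I.dualSampleMatrix ω j k : ℤ) : ℝ)| := by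
    rw [← Int.cast_abs, ← Int.natCast_natAbs, Int.cast_natCast]
  rw [h1, cast_dualSampleMatrix]
  calc |⟪((ω j : dualLattice I.lattice) : EuclideanSpace ℝ (Fin I.n)), I.vec k⟫_ℝ|
      ≤ ‖((ω j : dualLattice I.lattice) : EuclideanSpace ℝ (Fin I.n))‖ * ‖I.vec k‖ := abs_real_inner_le_norm _ _
    _ ≤ R * (I.n * M) := mul_le_mul (hω j) (I.norm_vec_le hM k) (norm_nonneg _) hR

/-- **The sample matrix on real vectors**: `(A u)ⱼ = ⟪v, wⱼ⟫` with `v = ∑ₖ uₖ bₖ = u B`.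
[cite: AharonovRegev2005, §6 test (c) — variant] -/
theorem dualSampleMatrix_mulVec_apply {N : ℕ} (ω : Fin N → dualLattice I.lattice) (u : Fin I.n → ℝ) (j : Fin N) :
    ((I.dualSampleMatrix ω).map (Int.cast : ℤ → ℝ) *ᵥ u) j =
      ⟪(WithLp.toLp 2 (u ᵥ* I.basis.map (Int.cast : ℤ → ℝ)) : EuclideanSpace ℝ (Fin I.n)),
        ((ω j : dualLattice I.lattice) : EuclideanSpace ℝ (Fin I.n))⟫_ℝ := by
  simp only [Matrix.mulVec, dotProduct, Matrix.map_apply, cast_dualSampleMatrix, inner_vec_eq_sum, Finset.sum_mul]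
  rw [Finset.sum_comm]
  simp only [PiLp.inner_apply, Matrix.vecMul, dotProduct, Matrix.map_apply, RCLike.inner_apply, conj_trivial]
  refine Finset.sum_congr rfl fun l _ ↦ ?_
  simp only [Finset.mul_sum]
  exact Finset.sum_congr rfl fun k _ ↦ by ring

/-- `‖u B‖² = (u B) · (u B)`. [folklore] -/
theorem norm_toLp_vecMul_sq (u : Fin I.n → ℝ) :
    ‖(WithLp.toLp 2 (u ᵥ* I.basis.map (Int.cast : ℤ → ℝ)) : EuclideanSpace ℝ (Fin I.n))‖ ^ 2 =
      (u ᵥ* I.basis.map (Int.cast : ℤ → ℝ)) ⬝ᵥ (u ᵥ* I.basis.map (Int.cast : ℤ → ℝ)) := by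
  rw [EuclideanSpace.norm_eq, Real.sq_sqrt (Finset.sum_nonneg fun _ _ ↦ sq_nonneg _), dotProduct]
  refine Finset.sum_congr rfl fun l _ ↦ ?_
  simp only [Real.norm_eq_abs, sq_abs]
  ring

end LatticeInstance

/-! ### Discharge of `FarCert.sample_exists` -/

namespace FarCert

/-- The polynomial of `sample_exists`: `q(L) = 40000 L⁴ + 4 L` (`N = 40000 n⁴ ≤ q(L)`,
`|A j k| ≤ 2^{4L} ≤ 2^{q(L)}`). [folklore] -/
def samplePoly : Polynomial ℕ := Polynomial.C 40000 * Polynomial.X ^ 4 + Polynomial.C 4 * Polynomial.X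

/-- Evaluation of `samplePoly`. [folklore] -/
theorem samplePoly_eval (L : ℕ) : samplePoly.eval L = 40000 * L ^ 4 + 4 * L := by
  simp [samplePoly]

/-- **Good samples with a margin** (Aharonov–Regev 2005, §6.2, for the counting test and the moment
threshold of `FarCert`, the moment clause with the factor `99/100`; constants `c₀ = 200`, `s = 100 d`,
`N = 40000 n⁴`, truncation `R = 3√n/s`): on a NO instance of `GapCVP_{200√n}`, among `N` i.i.d. samples of `D_{L*,1/s}` a good
tuple exists (`exists_good_farSamples`: tail — Banaszczyk 1.5 / Lemma 2.5 with `c = 3`; far count —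
`f_s(t) ≤ (2√(2πe)e^{-4π})ⁿ ≤ 2⁻⁹` by Lemma 3.1, bucketing `Pr[far] ≥ (1 − π²/32 − f)/(2 − π²/32) ≥ 2/5`
and Chebyshev with deviation `3N/20`; moments — Lemma 2.6 / 6.2 in second-moment form), and its
integer coordinates `A = (⟪wⱼ, bₖ⟫)` satisfy the four clauses: `N ≤ q(L)`, `|A j k| ≤ R n 2^L ≤ 2^{q(L)}`,
`N < 4 #far` (phases `aⱼ·(t adj B) = det B ⟪t, wⱼ⟫`), and `100 · 20000 num² ‖A u‖² ≤ 99 · N den² ‖u B‖²`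
(`∑ⱼ ⟪v, wⱼ⟫² ≤ (Nπ/(8s²) + √θ)‖v‖²` with `π/4 + 1/5 ≤ 99/100`); the margin `1/100` is what makes
the moment matrix of the certificate positive DEFINITE, so that an exact Gram certificate of
polynomial size exists by rounding (`LinearAlgebra/Matrix/IntegerGramCertificate.lean`).
[cite: AharonovRegev2005, §6.2 (Claim 6.1, Lemmas 6.2, 6.3; pp. 11–12) with Lemma 3.1, Claim 4.1 — variant (second-moment sampling, counting test)] -/
theorem sample_exists_strong (I : LatticeInstance) (t : Fin I.n → ℤ) (d : ℚ)
    (hno : ((⟨I, t⟩ : CVPInstance), d) ∈ GapCVP.no (fun n => 200 * Real.sqrt n)) :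
    ∃ (N : ℕ) (A : Matrix (Fin N) (Fin I.n) ℤ),
      N ≤ samplePoly.eval (gapCVPInstanceEncoding.encode ((⟨I, t⟩ : CVPInstance), d)).length ∧
      (∀ j k, (A j k).natAbs ≤ 2 ^ samplePoly.eval (gapCVPInstanceEncoding.encode ((⟨I, t⟩ : CVPInstance), d)).length) ∧
      N < 4 * farCountOf A I.basis.adjugate I.basis.det t ∧
      ∀ u : Fin I.n → ℝ,
        100 * (20000 * (d.num : ℝ) ^ 2 * ((A.map (Int.cast : ℤ → ℝ) *ᵥ u) ⬝ᵥ (A.map (Int.cast : ℤ → ℝ) *ᵥ u))) ≤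
          99 * ((N : ℝ) * (d.den : ℝ) ^ 2 *
            ((u ᵥ* I.basis.map (Int.cast : ℤ → ℝ)) ⬝ᵥ (u ᵥ* I.basis.map (Int.cast : ℤ → ℝ)))) := by
  rcases Nat.eq_zero_or_pos I.n with h0 | hn
  · exact absurd hno (not_mem_gapCVP_no_of_n_eq_zero _ (by simp) h0 d)
  obtain ⟨hI, hd, hfar⟩ := hno
  dsimp only at hI hd hfar
  haveI := LatticeInstance.isZLattice_of_isNonsingular hI
  have hfin : finrank ℝ (EuclideanSpace ℝ (Fin I.n)) = I.n := finrank_euclideanSpace_fin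
  have hn1 : 1 ≤ I.n := hn
  have hnR0 : (0 : ℝ) < I.n := by exact_mod_cast hn
  -- the data of the instance
  have hnum : 0 < d.num := Rat.num_pos.2 hd
  have hnumR : (0 : ℝ) < d.num := by exact_mod_cast hnum
  have hnumR1 : (1 : ℝ) ≤ d.num := by exact_mod_cast hnum
  have hdenR : (0 : ℝ) < d.den := by exact_mod_cast d.den_pos
  have hdR : (d : ℝ) = d.num / d.den := by exact_mod_cast (Rat.num_div_den d).symm
  rw [hdR] at hfar
  -- parameters (opaque, with defining equations)
  obtain ⟨s, hs_def⟩ : ∃ s : ℝ, s = 100 * ((d.num : ℝ) / d.den) := ⟨_, rfl⟩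
  have hs : 0 < s := by rw [hs_def]; positivity
  obtain ⟨NN, hNN⟩ : ∃ NN : ℕ, NN = 40000 * I.n ^ 4 := ⟨_, rfl⟩
  have hNNR : (NN : ℝ) = 40000 * (I.n : ℝ) ^ 4 := by rw [hNN]; push_cast; ring
  obtain ⟨θ, hθ_def⟩ : ∃ θ : ℝ, θ = ((NN : ℝ) * (d.den : ℝ) ^ 2 / (100000 * (d.num : ℝ) ^ 2)) ^ 2 := ⟨_, rfl⟩
  have hθ : 0 < θ := by rw [hθ_def, hNNR]; positivity
  obtain ⟨a, ha_def⟩ : ∃ a : ℝ, a = 3 * NN / 20 := ⟨_, rfl⟩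
  have ha : 0 < a := by rw [ha_def, hNNR]; positivity
  have hc3 : 1 / Real.sqrt (2 * π) ≤ 3 := one_div_sqrt_two_pi_le_one.trans (by norm_num)
  have hc2 : 1 / Real.sqrt (2 * π) ≤ 2 := one_div_sqrt_two_pi_le_one.trans (by norm_num)
  -- the budget of the three bad events, and a good tuple
  have hbudget : NN * (3 * Real.sqrt (2 * π * Real.exp 1) * Real.exp (-π * 3 ^ 2)) ^ finrank ℝ (EuclideanSpace ℝ (Fin I.n)) +
      NN * 1 ^ 2 / (4 * a ^ 2) +
      NN * Fintype.card (Fin I.n × Fin I.n) * ((3 * s⁻¹ * Real.sqrt (finrank ℝ (EuclideanSpace ℝ (Fin I.n)))) ^ 2) ^ 2 / θ < 1 := by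
    rw [hfin, Fintype.card_prod, Fintype.card_fin]
    exact sample_budget_lt_one hn1 hnumR hdenR hs_def hNNR hθ_def ha_def
  obtain ⟨ω, hω1, hω2, hω3⟩ := exists_good_farSamples I.lattice hs hc3 ha hθ (intVecToEuclidean I.n t)
    (EuclideanSpace.basisFun (Fin I.n) ℝ) NN hbudget
  have hω1' : ∀ j, ‖((ω j : dualLattice I.lattice) : EuclideanSpace ℝ (Fin I.n))‖ ≤ 3 * s⁻¹ * Real.sqrt (I.n : ℝ) :=
    fun j ↦ by have := hω1 j; rw [hfin] at this; exact this.le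
  -- the code length, made opaque
  obtain ⟨hnL, -, hBL, -, hdenL⟩ := sizes_le_length_encode_gapCVP I t d
  generalize (gapCVPInstanceEncoding.encode ((⟨I, t⟩ : CVPInstance), d)).length = Lc at hnL hBL hdenL ⊢
  refine ⟨NN, I.dualSampleMatrix ω, ?_, ?_, ?_, ?_⟩
  · -- `N ≤ q(L)`
    rw [samplePoly_eval, hNN]
    exact (Nat.mul_le_mul_left 40000 (Nat.pow_le_pow_left hnL 4)).trans (Nat.le_add_right _ _)
  · -- entries `|A j k| ≤ 2^{q(L)}`
    intro j k
    have hM : ∀ i k, (I.basis i k).natAbs ≤ 2 ^ Lc := fun i k ↦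
      (Nat.lt_size_self _).le.trans (Nat.pow_le_pow_right (by norm_num) (hBL i k))
    have h1 := I.natAbs_dualSampleMatrix_le ω hω1' hM j k
    have hR : 3 * s⁻¹ * Real.sqrt (I.n : ℝ) ≤ I.n * d.den := sample_radius_le hn1 hnumR1 hdenR hs_def
    have h2 : ((I.dualSampleMatrix ω j k).natAbs : ℝ) ≤ ((I.n * d.den * (I.n * 2 ^ Lc) : ℕ) : ℝ) := by
      refine h1.trans ?_
      push_cast
      exact mul_le_mul_of_nonneg_right hR (by positivity)
    have h3 : (I.dualSampleMatrix ω j k).natAbs ≤ I.n * d.den * (I.n * 2 ^ Lc) := by exact_mod_cast h2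
    refine h3.trans ?_
    have hden2 : d.den ≤ 2 ^ Lc := (Nat.lt_size_self _).le.trans (Nat.pow_le_pow_right (by norm_num) hdenL)
    have hn2 : I.n ≤ 2 ^ Lc := hnL.trans Nat.lt_two_pow_self.le
    calc I.n * d.den * (I.n * 2 ^ Lc) ≤ 2 ^ Lc * 2 ^ Lc * (2 ^ Lc * 2 ^ Lc) :=
          Nat.mul_le_mul (Nat.mul_le_mul hn2 hden2) (Nat.mul_le_mul_right _ hn2)
      _ = 2 ^ (4 * Lc) := by ring
      _ ≤ 2 ^ samplePoly.eval Lc :=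
          Nat.pow_le_pow_right (by norm_num) (by rw [samplePoly_eval]; exact Nat.le_add_left _ _)
  · -- the count `N < 4 #far`
    -- `f_s(t) ≤ 2⁻⁹`
    have hx : ∀ y : I.lattice, 2 * s * Real.sqrt (finrank ℝ (EuclideanSpace ℝ (Fin I.n))) ≤
        ‖(y : EuclideanSpace ℝ (Fin I.n)) - intVecToEuclidean I.n t‖ := by
      intro y
      rw [hfin]
      have h1 : infDist (intVecToEuclidean I.n t) (I.lattice : Set (EuclideanSpace ℝ (Fin I.n))) ≤
          dist (intVecToEuclidean I.n t) y := Metric.infDist_le_dist_of_mem y.2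
      rw [dist_eq_norm, ← norm_neg, neg_sub] at h1
      have h2 : 2 * s * Real.sqrt (I.n : ℝ) = 200 * Real.sqrt (I.n : ℝ) * ((d.num : ℝ) / d.den) := by
        rw [hs_def]; ring
      rw [h2]
      exact (le_of_lt hfar).trans h1
    have hZ : 0 < ∑' y : I.lattice, gaussianFunction s ((y : EuclideanSpace ℝ (Fin I.n))) := by
      have := tsum_gaussianFunction_sub_pos I.lattice hs.ne' (0 : EuclideanSpace ℝ (Fin I.n))
      simpa only [sub_zero] using this
    have hf : (∑' y : I.lattice, gaussianFunction s ((y : EuclideanSpace ℝ (Fin I.n)) - intVecToEuclidean I.n t)) /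
        (∑' y : I.lattice, gaussianFunction s (y : EuclideanSpace ℝ (Fin I.n))) ≤ 1 / 2 ^ 9 := by
      rw [div_le_iff₀ hZ]
      refine (tsum_gaussianFunction_sub_le_pow_mul_of_forall_le I.lattice hs hc2 hx).trans ?_
      refine mul_le_mul_of_nonneg_right ?_ hZ.le
      rw [hfin]
      exact banaszczykConst_two_pow_le hn.ne'
    -- `Pr[far] ≥ 2/5`, hence `N/4 ≤ N Pr[far] − a < #far`
    have hm25 := two_fifths_le_of_bucketing (sub_le_mul_integral_farInd I.lattice hs (intVecToEuclidean I.n t)) hf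
    have hcount := I.sum_farInd_le_farCountOf hI ω t
    have hNN0 : (0 : ℝ) ≤ NN := Nat.cast_nonneg _
    have hlt : (NN : ℝ) < 4 * (farCountOf (I.dualSampleMatrix ω) I.basis.adjugate I.basis.det t : ℝ) := by
      have h1 : (NN : ℝ) * (2 / 5) ≤ (NN : ℝ) * ∫ w, farInd (intVecToEuclidean I.n t)
          ((w : dualLattice I.lattice) : EuclideanSpace ℝ (Fin I.n)) ∂(dualGaussian I.lattice s).toMeasure :=
        mul_le_mul_of_nonneg_left hm25 hNN0
      rw [ha_def] at hω2
      linarith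
    exact_mod_cast hlt
  · -- the moment bound
    intro u
    have hRpos : 0 < 3 * s⁻¹ * Real.sqrt (finrank ℝ (EuclideanSpace ℝ (Fin I.n))) := by
      rw [hfin]; exact mul_pos (mul_pos (by norm_num) (inv_pos.2 hs)) (Real.sqrt_pos.2 hnR0)
    have hgood := sum_inner_sq_le_of_good I.lattice hs hRpos (EuclideanSpace.basisFun (Fin I.n) ℝ)
      (fun j ↦ (hω1 j).le) hω3.le (WithLp.toLp 2 (u ᵥ* I.basis.map (Int.cast : ℤ → ℝ)))
    have hAu : ((I.dualSampleMatrix ω).map (Int.cast : ℤ → ℝ) *ᵥ u) ⬝ᵥ ((I.dualSampleMatrix ω).map (Int.cast : ℤ → ℝ) *ᵥ u) =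
        ∑ j, ⟪(WithLp.toLp 2 (u ᵥ* I.basis.map (Int.cast : ℤ → ℝ)) : EuclideanSpace ℝ (Fin I.n)),
          ((ω j : dualLattice I.lattice) : EuclideanSpace ℝ (Fin I.n))⟫_ℝ ^ 2 := by
      rw [dotProduct]
      refine Finset.sum_congr rfl fun j _ ↦ ?_
      rw [I.dualSampleMatrix_mulVec_apply ω u j, sq]
    rw [hAu, ← I.norm_toLp_vecMul_sq u]
    have hcoef : 100 * (20000 * (d.num : ℝ) ^ 2 * ((NN : ℝ) * (π / (8 * s ^ 2)) + Real.sqrt θ)) ≤ 99 * ((NN : ℝ) * (d.den : ℝ) ^ 2) :=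
      sample_moment_coef_le_strong hnumR hdenR (Nat.cast_nonneg _) hs_def hθ_def
    have hv0 : 0 ≤ ‖(WithLp.toLp 2 (u ᵥ* I.basis.map (Int.cast : ℤ → ℝ)) : EuclideanSpace ℝ (Fin I.n))‖ ^ 2 := sq_nonneg _
    calc 100 * (20000 * (d.num : ℝ) ^ 2 * ∑ j, ⟪(WithLp.toLp 2 (u ᵥ* I.basis.map (Int.cast : ℤ → ℝ)) : EuclideanSpace ℝ (Fin I.n)),
          ((ω j : dualLattice I.lattice) : EuclideanSpace ℝ (Fin I.n))⟫_ℝ ^ 2)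
        ≤ 100 * (20000 * (d.num : ℝ) ^ 2 * (((NN : ℝ) * (π / (8 * s ^ 2)) + Real.sqrt θ) *
            ‖(WithLp.toLp 2 (u ᵥ* I.basis.map (Int.cast : ℤ → ℝ)) : EuclideanSpace ℝ (Fin I.n))‖ ^ 2)) := by
          gcongr
      _ = 100 * (20000 * (d.num : ℝ) ^ 2 * ((NN : ℝ) * (π / (8 * s ^ 2)) + Real.sqrt θ)) *
            ‖(WithLp.toLp 2 (u ᵥ* I.basis.map (Int.cast : ℤ → ℝ)) : EuclideanSpace ℝ (Fin I.n))‖ ^ 2 := by ring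
      _ ≤ 99 * ((NN : ℝ) * (d.den : ℝ) ^ 2) *
            ‖(WithLp.toLp 2 (u ᵥ* I.basis.map (Int.cast : ℤ → ℝ)) : EuclideanSpace ℝ (Fin I.n))‖ ^ 2 :=
          mul_le_mul_of_nonneg_right hcoef hv0
      _ = _ := by ring

/-- **Discharge of `FarCert.sample_exists`** (Aharonov–Regev 2005, §6.2 for the counting test and the
moment threshold of `FarCert`): `sample_exists_strong` with the margin dropped.
[cite: AharonovRegev2005, §6.2 (Claim 6.1, Lemmas 6.2, 6.3; pp. 11–12) with Lemma 3.1, Claim 4.1 — variant (second-moment sampling, counting test)] -/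
theorem sample_exists_holds : sample_exists := by
  refine ⟨200, by norm_num, samplePoly, fun I t d hno => ?_⟩
  obtain ⟨N, A, h1, h2, h3, h4⟩ := sample_exists_strong I t d hno
  refine ⟨N, A, h1, h2, h3, fun u => ?_⟩
  have h5 := h4 u
  have h6 : 0 ≤ (N : ℝ) * (d.den : ℝ) ^ 2 *
      ((u ᵥ* I.basis.map (Int.cast : ℤ → ℝ)) ⬝ᵥ (u ᵥ* I.basis.map (Int.cast : ℤ → ℝ))) :=
    mul_nonneg (by positivity) (Finset.sum_nonneg fun i _ => mul_self_nonneg _)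
  linarith

end FarCert

/-! ### Corollaries: what Cor. 1.2 is now conditional on -/

/-- **Thm. 1.1, coNP part, from the machine and the certificate algebra** (the sampling is
discharged). [cite: AharonovRegev2005, Thm. 1.1 (p. 2) and §6] -/
theorem gapCVP_sqrt_mem_promiseCoNP_of_psd (hV : FarCert.verifier_mem_P) (h2 : FarCert.psd_cert_exists) :
    gapCVP_sqrt_mem_promiseCoNP :=
  gapCVP_sqrt_mem_promiseCoNP_of_sample hV FarCert.sample_exists_holds h2

/-- **Aharonov–Regev 2005, Cor. 1.2 — conditional form after this file**: the vendored fact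
`gapSVP_sqrt_mem_promiseNP_inter_promiseCoNP` depends on exactly two named facts,
`FarCert.verifier_mem_P` (the TM2 verifier machine) and `FarCert.psd_cert_exists` (exact PSD
certificates of polynomial size). [cite: AharonovRegev2005, Cor. 1.2 (p. 2), from Thm. 1.1 and Lemma A.1 (p. 14)] -/
theorem gapSVP_sqrt_mem_promiseNP_inter_promiseCoNP_of_psd (hV : FarCert.verifier_mem_P)
    (h2 : FarCert.psd_cert_exists) : gapSVP_sqrt_mem_promiseNP_inter_promiseCoNP :=
  gapSVP_sqrt_mem_promiseNP_inter_promiseCoNP_of_sample hV FarCert.sample_exists_holds h2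

end Literature.Algebra.EuclideanLattices

end
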